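import Summits.ABC.ABC.Theses.DefiniteXi
import Literature.NumberTheory.EllipticCurves.SzpiroFreyConductorProofs
import Literature.NumberTheory.EllipticCurves.PastenValuationProductTamagawaProofs
import Mathlib.Analysis.SpecificLimits.Normed

/-!
# Disproof of `EisensteinQuarantine` (stmt-ABC-15023, route ABC/DefiniteXi) — standing adversary file

Crux: `∀ ε > 0 ∃ C`, for all coprime `a, b` (`ab(a+b) ≠ 0`), `N = N(E_(a,b))`, every admissible `N⁻ = Nm`
(odd, squarefree, `ω` odd, `Nm ∣ N`):
`sixPart ξ := ordProj[2] ξ · ordProj[3] ξ ≤ C · N^ε · 𝓛`, `ξ = brandtXi (N/Nm) Nm (a_n(E))`,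
`𝓛 = ∏_{q ∈ N.primeFactors \ Nm.primeFactors} v_q(Δ_min)`.

## Findings (cycle 1, refuter-cdisprove-stmt-ABC-15023-0, 2026-08-16) — VERDICT: census-false, substantively

1. **No cheap / junk kill.**  `𝓛 ≥ 1` on the whole domain (`allowance_ne_zero`: the conductor's primes divide
   `Δ_min`), `brandtXi` is a genuine setup value there (tree: `nonempty_xiSetup_freyCurve`), `sixPart ≥ 1`; dropping
   `Squarefree Nm` / `Odd ω(Nm)` / `Nm ∣ N` only adds junk-`0` instances (`sixPart 0 = 1 ≤ C`).  No hypothesis of the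
   crux is load-bearing for its falsity: what is wrong is the SHAPE of the allowance (finding 3).
2. **The kill family** (ideator 2 / lead memo `Lines/Sketch.md`, confirmed and extended here DIRECTLY on the Brandt side):
   `E = E_(−p, p−1)` (Legendre `y² = X(X−1)(X−p)`), `p = k·2^s + 1` prime, `Nm := p`.  All Atkin–Lehner signs of
   `f_E` are the Eisenstein signs (split multiplicative at every bad prime), and `2^{s−2} ∣ num((p−1)/12)` = index of
   Mazur's Eisenstein ideal of level `p`.  DIRECT census of `ξ(E; N/p, p)` (this seat's engine `brandt3.py`: Pizer's
   method in the definite algebra `B_{p,∞}`, Eichler order of level `N/p`, classes by neighbours, certified by Eichler's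
   mass formula and the `w`-symmetry of every Brandt matrix; eigen-line exact-verified; validated on 7 independent values
   incl. the Lean-native census `ξ(2,257) = 128`, `ξ(259;3) = 48`; kit j017527, 54 levels, `h ≤ 12300`):
   `v₂ ξ(N/p, p)`:  k=3: s=5,6,8,12 ↦ 6,8,9,10 (p = 97,193,769,12289);  k=9: s=6,7 ↦ 11,9;  k=1: s=8 ↦ 7;  k=13: s=8 ↦ 9;
   k=25: s=6 ↦ 10;  k=21: s=5 ↦ 13;  k=7: s=6 ↦ 10;  k=11: s=5,7 ↦ 8,7;  k=27: s=7 ↦ 7;  k=29: s=5 ↦ 7.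
   The allowance at `Nm = p` is `𝓛 = (2s−8)·∏_{q∣k} 2v_q(k)` — POLYNOMIAL in `s` — so `sixPart ξ/𝓛 = N^{θ}` with
   `θ ∈ [0.30, 0.78]` on these levels (`N ≤ 10⁵`) and `θ → 1` along the family (`v₂ ξ = s − O(1)`, `log₂ N = s + O(log k)`).
   The modular-degree census (kit j017464, PARI `ellmoddegree`; ideator j016666 to `s = 16`) agrees via Takahashi
   `deg · i_p = ξ(N/p,p) · j_p`, `i_p j_p ∣ … c_p = 2`: `v₂ deg(E_Frey) = v₂ ξ + 1`.
3. **Quarantining another prime does not help** (new): at `(N⁺, N⁻) = (N/q, q)` for the SMALL bad primes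
   `q ∈ {3,5,7,11,13,29}` of the same curves, `v₂ ξ` drops by exactly 2 (occasionally 3) and keeps growing with `s`:
   `(2p,3)`: s=5,6,8,12 ↦ 4,6,7,8; `(2p·7, 3)`/`(2p·3, 7)` for k=21: 11, 11 (direct 13); `(706,11)`: 6 (8); `(6658,13)`: 7 (9).
   So the glue's freedom to pick `Nm` (DefiniteGlue takes one odd prime) cannot rescue the statement: the Eisenstein depth
   of `p` sits in `ξ` whether `p` is quarantined or not, while `𝓛` pays only `v_p(Δ_min) = 2` for it.
4. **Controls.** `(p+1)`-type `E_(−1,p+1)`, `p = k 2^s − 1` (non-split at `p`): Mersenne s=5,7,13 ↦ 1,3,7 (≈ s/2),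
   k=3: s=6,7,11 ↦ 8,8,9; composite k larger (k=15, s=5: 13).  3-adic part: irregular (`f_E` is not Eisenstein mod 3):
   t=4 ↦ v₃ ξ = 1,1,4; t=5 ↦ 3 — no clean 3-adic law, but also no 3-adic rescue.
5. **Repairs, graded on the data.**  Sign-blind C″ (lead): `sixPart ξ ≤ C_ε N^ε · 𝓛 · ∏_{q∣N odd} sixPart(q²−1)` —
   CONSISTENT with all 54 levels (tight: `(42, 673)`: `2^13 = 8·16·64` exactly).  Sign-aware C‴ (`q − a_q(E)`):
   DISFAVOURED (`(42,673)`: 13 bits observed vs `1+1+5 (+3 allowance)`).  Cost of C″ for the route: the new factor is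
   `≍ N²` on `N = 2p`, so C″ ∧ SteinbergCore gives `deg ≤ N^{4+ε}`, not `2+ε` (lead memo §4).
6. **Kernel-checked reduction** (this file, no `sorry`; also filed as the Negative lemma
   `Theorems/EisensteinQuarantine/Negative/FalseOfPierpontDepthLaw.lean`):
   `minimalDiscriminantNorm_freyCurve_of_mod → PierpontDepthLaw → PierpontPrimesWithSmallThreePart → ¬ EisensteinQuarantine`
   (`ε = 1/8`; `2^{5s} ≤ C⁸ 2^{8c+25} s^{16}` is absurd).  The ONLY unproved arithmetic input is the depth law
   (`pierpontDepthLaw_census`, sorried below with the obstruction); the primes hypothesis is a standard conjecture.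
7. WHY IT RESISTS A LEAN `¬`: `brandtXi` is `Classical.choice` of a setup's `ξ`; the tree now has setup existence and
   setup-independence, but evaluating `S.xi` needs an explicit definite quaternion algebra over `ℚ` as a Lean type with its
   class set and Brandt matrices — not constructible/decidable in the tree.
8. **Linear growth confirmed independently to `s = 16` (PARI `ellmoddegree`, kit j017919, deg/c² of the Frey model):**
   `p = 12289 (s=12): deg = 2^11·653` (= 2·ξ(6,12289) EXACTLY, same odd part 653 — engine/PARI cross-check);
   `18433 (s=11, k=9): 2^15·…`; `65537 (s=16): 2^15·3·5·17`; `40961 (s=13, k=5): 2^12·3²·…`; `147457 (s=14, k=9): 2^15·…`,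
   i.e. `v₂ deg = s−1, s+4, s−1, s−1, s+1`; by Takahashi (`deg·i_p = ξ·j_p`, `i_p j_p ∣ v_p(Δ_min) = 2`, tree fact
   `takahashi2001_thm_2_3`) `v₂ ξ(N/p,p) ≥ v₂ deg_opt − 1`: the depth law holds with `c ≤ 3` through `s = 16`.
   Reruns kit j017692: `(38,1217)` k=19 s=6 ↦ `2^12·3²`, `(2434,19)` ↦ `2^10·3²`; `(10,641)` ↦ `2^7·3³`, `(1282,5)` ↦ `2^5·3³`;
   `(36866,3)` [18433] ↦ `2^11`; `(37646,3)` [2689] ↦ `2^10·3`.  Still running at hand-over (evidence auto-attached to the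
   item on completion): j017797 (`(2,65537)`, `(6,18433)`, `(10,40961)`, `(30,7681)`, `(26,13313)`, F3 `(2,131071)` …, adaptive
   Hecke operators + strict classification), j017694/j017783 (`(6,786433)` s=18, `(1572866,3)`, `(6,786431)`, `(2,524287)`,
   `(6,147457)`, `(14,114689)`, `(10,163841)`), j017880 (MAXIMAL quarantine `Nm = p·rad(k)` for `ω(k) = 2`, engine brandt4.py
   validated on 9 composite-`N⁻` values of the Lean-native census) — predictions from 8.: `v₂ ξ = 14, 14, 11, …; 16`.
-/

-- `Summit.<Summit>.<Problem>`: for the single-conjunct summit `ABC` the duplicate `ABC.ABC` is mandated.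
set_option linter.dupNamespace false

noncomputable section

namespace Summit.ABC.ABC.Cruxes.EisensteinQuarantine.Disproof

open Literature.NumberTheory.Automorphic Literature.NumberTheory.EllipticCurves
open Filter Asymptotics

/-! ## §1 Load-bearing analysis: no junk kill -/

/-- On the crux's domain every prime of the conductor divides `Δ_min`, so the allowance
`𝓛 = ∏_{q ∣ N, q ∤ Nm} v_q(Δ_min)` is a positive integer: the RHS is never the junk value `0`
(hence no kill from `sixPart ξ ≥ 1 > 0`). [folklore] -/
theorem allowance_ne_zero {a b : ℤ} (h0 : a * b * (a + b) ≠ 0) {N : ℕ}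
    (hN : (freyCurve a b).conductorNorm ℤ = N) (s : Finset ℕ) :
    ∏ q ∈ N.primeFactors \ s, ((freyCurve a b).minimalDiscriminantNorm ℤ).factorization q ≠ 0 := by
  haveI := isElliptic_freyCurve h0
  refine Finset.prod_ne_zero_iff.mpr fun q hq => ?_
  have hq' : q ∈ ((freyCurve a b).minimalDiscriminantNorm ℤ).primeFactors := by
    rw [← primeFactors_conductorNorm_eq (freyCurve a b), hN]
    exact (Finset.mem_sdiff.mp hq).1
  rw [← Nat.support_factorization] at hq'
  exact Finsupp.mem_support_iff.mp hq'

/-- The left-hand side of the crux is always `≥ 1` (`ordProj[p] n ≥ 1`, also at the junk value `ξ = 0` where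
`ordProj[p] 0 = 1`): instances WITHOUT a Brandt setup (guards dropped) are harmless, never refuting. [folklore] -/
theorem one_le_sixPart (ξ : ℕ) : 1 ≤ ordProj[2] ξ * ordProj[3] ξ :=
  Nat.one_le_iff_ne_zero.mpr (Nat.mul_ne_zero (Nat.ordProj_pos ξ 2).ne' (Nat.ordProj_pos ξ 3).ne')

/-! ## §2 The kill family and the kernel-checked conditional refutation -/


/-- The eigenvalue system `n ↦ a_n` of the Pierpont–Legendre Frey curve `E_(−(M+1), M)`, `M = 2^s 3^t`. -/
abbrev pierpontLam (s t : ℕ) : ℕ → ℤ :=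
  fun n => (freyCurve (-((2 ^ s * 3 ^ t + 1 : ℕ) : ℤ)) ((2 ^ s * 3 ^ t : ℕ) : ℤ)).LFunction n

/-- **The 2-adic Eisenstein depth law along Pierpont–Legendre Frey curves** (census-backed, NOT
proved; kit j017464/j017527/j017528 of this seat, ideator census j016666): there is `c` such that for
every Pierpont prime `p = 2^s 3^t + 1` (`s ≥ 5`, `t ≥ 1`) the 2-part of the quarantined congruence number
`ξ(E_(−p, p−1); N/p, p)` is at least `2^{s−c}`.  Mechanism: all Atkin–Lehner signs of `f_E` are the
Eisenstein signs and `2^{s−2} ∣ num((p−1)/12)`, the index of Mazur's Eisenstein ideal of level `p`. [cite: Mazur1977] -/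
def PierpontDepthLaw : Prop :=
  ∃ c : ℕ, ∀ s t : ℕ, 5 ≤ s → 1 ≤ t → Nat.Prime (2 ^ s * 3 ^ t + 1) →
    ∀ N : ℕ, (freyCurve (-((2 ^ s * 3 ^ t + 1 : ℕ) : ℤ)) ((2 ^ s * 3 ^ t : ℕ) : ℤ)).conductorNorm ℤ = N →
      2 ^ s ≤ 2 ^ c * ordProj[2] (brandtXi (N / (2 ^ s * 3 ^ t + 1)) (2 ^ s * 3 ^ t + 1) (pierpontLam s t))

/-- **Pierpont primes with small 3-part are unbounded** (standard conjecture, Bateman–Horn type; NOT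
proved): for every `s₀` there is a prime `2^s 3^t + 1` with `s ≥ s₀`, `t ≥ 1` and `3^{8t} ≤ 2^s`. [folklore] -/
def PierpontPrimesWithSmallThreePart : Prop :=
  ∀ s₀ : ℕ, ∃ s t : ℕ, s₀ ≤ s ∧ 1 ≤ t ∧ 3 ^ (8 * t) ≤ 2 ^ s ∧ Nat.Prime (2 ^ s * 3 ^ t + 1)

/-- Exponential beats polynomial: for every real `K` there is `s₀` with `K · s^16 < 2^(5s)` for `s ≥ s₀`. -/
theorem eventually_const_mul_pow_lt_two_pow (K : ℝ) :
    ∃ s₀ : ℕ, ∀ s : ℕ, s₀ ≤ s → K * (s : ℝ) ^ 16 < (2 : ℝ) ^ (5 * s) := by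
  have ho : (fun n : ℕ => ((n : ℝ) ^ 16 : ℝ)) =o[atTop] fun n : ℕ => (2 : ℝ) ^ n :=
    isLittleO_pow_const_const_pow_of_one_lt 16 one_lt_two
  have hK : 0 < 1 / (2 * (|K| + 1)) := by positivity
  have hev := (isLittleO_iff.mp ho) hK
  obtain ⟨s₀, hs₀⟩ := eventually_atTop.mp hev
  refine ⟨s₀, fun s hs => ?_⟩
  have h := hs₀ s hs
  rw [Real.norm_of_nonneg (by positivity), Real.norm_of_nonneg (by positivity)] at h
  have h2 : (2 : ℝ) ^ s ≤ (2 : ℝ) ^ (5 * s) := pow_le_pow_right₀ (by norm_num) (by omega)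
  have h3 : K * (s : ℝ) ^ 16 ≤ (|K| + 1) * (s : ℝ) ^ 16 := by
    have : K ≤ |K| + 1 := (le_abs_self K).trans (by linarith)
    exact mul_le_mul_of_nonneg_right this (by positivity)
  have h4 : (|K| + 1) * (s : ℝ) ^ 16 ≤ (|K| + 1) * (1 / (2 * (|K| + 1)) * (2 : ℝ) ^ s) :=
    mul_le_mul_of_nonneg_left h (by positivity)
  have h5 : (|K| + 1) * (1 / (2 * (|K| + 1)) * (2 : ℝ) ^ s) = (2 : ℝ) ^ s / 2 := by
    field_simp
  have h6 : (2 : ℝ) ^ s / 2 < (2 : ℝ) ^ s := by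
    have : (0 : ℝ) < (2 : ℝ) ^ s := by positivity
    linarith
  linarith

/-- **`EisensteinQuarantine` is false under the Pierpont depth law** (modulo the existence of the
primes and the tree's Serre/Diamond–Kramer minimal-discriminant fact).  At `ε = 1/8`, `N⁻ = p`,
`(a, b) = (−p, p − 1)`: the crux bounds `2^{s−c} ≤ ordProj[2] ξ ≤ sixPart ξ ≤ C N^{1/8} (2s−8)(2t)` with
`N ≤ 2⁸ p (p−1) ≤ 2^{3s+9}`, i.e. `2^{5s} ≤ C⁸ 2^{8c+25} s^{16}` — absurd for large `s`. -/
theorem eisensteinQuarantine_false_of_pierpontDepthLaw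
    (hΔ : ∀ a b : ℤ, minimalDiscriminantNorm_freyCurve_of_mod a b)
    (hD : PierpontDepthLaw) (hP : PierpontPrimesWithSmallThreePart) :
    ¬ Summit.ABC.ABC.Theses.DefiniteXi.EisensteinQuarantine := by
  intro hEQ
  obtain ⟨c, hc⟩ := hD
  obtain ⟨C, hC⟩ := hEQ (1 / 8) (by norm_num)
  -- constants and the eventual inequality
  set C' : ℝ := max C 1 with hC'
  have hC'1 : 1 ≤ C' := le_max_right _ _
  have hC'0 : 0 ≤ C' := zero_le_one.trans hC'1
  obtain ⟨s₀, hs₀⟩ := eventually_const_mul_pow_lt_two_pow (C' ^ 8 * (2 : ℝ) ^ (8 * c + 25))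
  obtain ⟨s, t, hs, ht, h3t, hp⟩ := hP (max s₀ 5)
  have hs5 : 5 ≤ s := le_of_max_le_right hs
  have hss₀ : s₀ ≤ s := le_of_max_le_left hs
  -- the instance
  set M : ℕ := 2 ^ s * 3 ^ t with hM
  set P : ℕ := 2 ^ s * 3 ^ t + 1 with hP'
  have hM0 : 0 < M := by positivity
  have hP2 : P ≠ 2 := by
    intro h; have : 2 ^ 5 ≤ 2 ^ s := Nat.pow_le_pow_right (by norm_num) hs5
    have : 2 ^ s ≤ M := Nat.le_mul_of_pos_right _ (by positivity)
    omega
  have hP3 : P ≠ 3 := by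
    intro h; have : 2 ^ 5 ≤ 2 ^ s := Nat.pow_le_pow_right (by norm_num) hs5
    have : 2 ^ s ≤ M := Nat.le_mul_of_pos_right _ (by positivity)
    omega
  set a : ℤ := -(P : ℤ) with ha
  set b : ℤ := (M : ℤ) with hb
  have hPM1 : (P : ℤ) = (M : ℤ) + 1 := by rw [hP', hM]; push_cast; ring
  have hab_sum : a + b = -1 := by rw [ha, hb, hPM1]; ring
  have habc : a * b * (a + b) = (P : ℤ) * M := by rw [hab_sum, ha, hb]; ring
  have hPM0 : (P : ℤ) * M ≠ 0 := by positivity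
  have h0 : a * b * (a + b) ≠ 0 := by rw [habc]; exact hPM0
  have hcopPM : Nat.Coprime P M := by
    have : Nat.Coprime (M + 1) M := by
      rw [Nat.Coprime, Nat.gcd_comm, Nat.gcd_self_add_right, Nat.gcd_one_right]
    exact this
  have hab : IsCoprime a b := by
    rw [ha, hb, IsCoprime.neg_left_iff, Int.isCoprime_iff_gcd_eq_one, Int.gcd_natCast_natCast]
    exact hcopPM
  have ha4 : a ≡ -1 [ZMOD 4] := by
    -- P = 2^s 3^t + 1 ≡ 1 (mod 4) since s ≥ 2
    have h4 : (4 : ℤ) ∣ (M : ℤ) := by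
      have : (4 : ℕ) ∣ M := by
        rw [hM]; exact Dvd.dvd.mul_right (by
          calc (4 : ℕ) = 2 ^ 2 := by norm_num
            _ ∣ 2 ^ s := Nat.pow_dvd_pow 2 (by omega)) _
      exact_mod_cast this
    have : a = -1 - (M : ℤ) := by rw [ha, hPM1]; ring
    rw [this]
    calc -1 - (M : ℤ) ≡ -1 - 0 [ZMOD 4] := Int.ModEq.sub_left _ ((Int.modEq_zero_iff_dvd).mpr h4)
      _ = -1 := by ring
  have hb32 : (32 : ℤ) ∣ b := by
    have : (32 : ℕ) ∣ M := by
      rw [hM]; exact Dvd.dvd.mul_right (by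
        calc (32 : ℕ) = 2 ^ 5 := by norm_num
          _ ∣ 2 ^ s := Nat.pow_dvd_pow 2 hs5) _
    rw [hb]; exact_mod_cast this
  -- the curve, conductor, minimal discriminant
  set E := freyCurve a b with hE
  haveI : E.IsElliptic := isElliptic_freyCurve h0
  -- generalise the (noncomputable) conductor / minimal discriminant to opaque naturals
  obtain ⟨N, hN⟩ : ∃ N : ℕ, E.conductorNorm ℤ = N := ⟨_, rfl⟩
  have hNpos : 0 < N := hN ▸ WeierstrassCurve.conductorNorm_pos_holds E
  haveI : NeZero N := ⟨hNpos.ne'⟩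
  obtain ⟨D, hD'⟩ : ∃ D : ℕ, E.minimalDiscriminantNorm ℤ = D := ⟨_, rfl⟩
  have hD8 : 2 ^ 8 * D = P ^ 2 * 2 ^ (2 * s) * 3 ^ (2 * t) := by
    have h := hΔ a b hab h0 ha4 hb32
    rw [habc] at h
    change 2 ^ 8 * E.minimalDiscriminantNorm ℤ = _ at h
    rw [hD'] at h
    have : (((P : ℤ) * M) ^ 2).natAbs = P ^ 2 * 2 ^ (2 * s) * 3 ^ (2 * t) := by
      rw [Int.natAbs_pow, Int.natAbs_mul, Int.natAbs_natCast, Int.natAbs_natCast, hM]; ring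
    rw [← this]; exact h
  have hDval : D = P ^ 2 * 2 ^ (2 * s - 8) * 3 ^ (2 * t) := by
    have h28 : 2 ^ (2 * s) = 2 ^ 8 * 2 ^ (2 * s - 8) := by
      rw [← pow_add]; congr 1; omega
    have : 2 ^ 8 * D = 2 ^ 8 * (P ^ 2 * 2 ^ (2 * s - 8) * 3 ^ (2 * t)) := by rw [hD8, h28]; ring
    exact Nat.eq_of_mul_eq_mul_left (by positivity) this
  have hP0 : P ≠ 0 := hp.ne_zero
  -- prime factors and factorization of D
  have hDpf : D.primeFactors = {2, 3, P} := by
    rw [hDval, Nat.primeFactors_mul (by positivity) (by positivity),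
      Nat.primeFactors_mul (by positivity) (by positivity),
      Nat.primeFactors_pow _ (by norm_num), Nat.primeFactors_prime_pow (by omega) Nat.prime_two,
      Nat.primeFactors_prime_pow (by omega) Nat.prime_three, hp.primeFactors]
    ext q; simp [Finset.mem_insert, Finset.mem_singleton]; tauto
  have hfac2 : D.factorization 2 = 2 * s - 8 := by
    rw [hDval, Nat.factorization_mul (by positivity) (by positivity),
      Nat.factorization_mul (by positivity) (by positivity)]
    simp only [Finsupp.add_apply, Nat.factorization_pow, Finsupp.smul_apply, smul_eq_mul,
      Nat.Prime.factorization_self Nat.prime_two]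
    rw [hp.factorization, Nat.prime_three.factorization]
    simp [hP2]
  have hfac3 : D.factorization 3 = 2 * t := by
    rw [hDval, Nat.factorization_mul (by positivity) (by positivity),
      Nat.factorization_mul (by positivity) (by positivity)]
    simp only [Finsupp.add_apply, Nat.factorization_pow, Finsupp.smul_apply, smul_eq_mul,
      Nat.Prime.factorization_self Nat.prime_three]
    rw [hp.factorization, Nat.prime_two.factorization]
    simp [hP3]
  have hNpf : N.primeFactors = {2, 3, P} := by
    rw [← hN, primeFactors_conductorNorm_eq E, hD']; exact hDpf
  have hPN : P ∣ N := Nat.dvd_of_mem_primeFactors (by rw [hNpf]; simp)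
  -- admissibility of Nm := P
  have hPodd : Odd P := hp.odd_of_ne_two hP2
  have hPsq : Squarefree P := hp.squarefree
  have hPcard : Odd P.primeFactors.card := by rw [hp.primeFactors]; simp
  -- the crux at this instance (then make ξ and Δ_min opaque)
  have hcrux := hC a b hab h0 N hN P hPodd hPsq hPcard hPN
  obtain ⟨ξ, hξ⟩ : ∃ ξ : ℕ, brandtXi (N / P) P (fun n => E.LFunction n) = ξ := ⟨_, rfl⟩
  change ((ordProj[2] (brandtXi (N / P) P (fun n => E.LFunction n)) *
      ordProj[3] (brandtXi (N / P) P (fun n => E.LFunction n)) : ℕ) : ℝ) ≤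
    C * (N : ℝ) ^ (1 / 8 : ℝ) * ((∏ q ∈ N.primeFactors \ P.primeFactors,
      (E.minimalDiscriminantNorm ℤ).factorization q : ℕ) : ℝ) at hcrux
  rw [hξ, hD'] at hcrux
  -- the allowance
  have hsdiff : N.primeFactors \ P.primeFactors = {2, 3} := by
    rw [hNpf, hp.primeFactors]
    ext q; simp only [Finset.mem_sdiff, Finset.mem_insert, Finset.mem_singleton]
    constructor
    · rintro ⟨h1 | h1 | h1, h2⟩
      · exact Or.inl h1
      · exact Or.inr h1
      · exact absurd h1 h2
    · rintro (h1 | h1)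
      · exact ⟨Or.inl h1, fun h => hP2 (h.symm.trans h1)⟩
      · exact ⟨Or.inr (Or.inl h1), fun h => hP3 (h.symm.trans h1)⟩
  have hL : (∏ q ∈ N.primeFactors \ P.primeFactors, D.factorization q) = (2 * s - 8) * (2 * t) := by
    rw [hsdiff, Finset.prod_pair (by norm_num), hfac2, hfac3]
  -- depth law at this instance
  have hdepth : 2 ^ s ≤ 2 ^ c * ordProj[2] ξ := by
    have h := hc s t hs5 ht hp N hN
    change 2 ^ s ≤ 2 ^ c * ordProj[2] (brandtXi (N / P) P (fun n => E.LFunction n)) at h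
    rwa [hξ] at h
  -- size of N :  N ∣ 2^8 rad(ab(a+b)) ≤ 2^8 · P · M
  have hNle : N ≤ 2 ^ 8 * (P * M) := by
    have hdvd : N ∣ 2 ^ 8 * (UniqueFactorizationMonoid.radical (a * b * (a + b))).natAbs := by
      have h := conductorNorm_freyCurve_dvd_holds a b hab h0
      rwa [show (freyCurve a b).conductorNorm ℤ = N from hN] at h
    rw [habc] at hdvd
    have hrad : (UniqueFactorizationMonoid.radical ((P : ℤ) * M)).natAbs ≤ P * M := by
      have : ((P : ℤ) * M) = ((P * M : ℕ) : ℤ) := by push_cast; ring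
      rw [this, Int.radical_natCast, Int.natAbs_natCast]
      exact Nat.radical_le_self_iff.mpr (by positivity)
    exact (Nat.le_of_dvd (by positivity) hdvd).trans (Nat.mul_le_mul_left _ hrad)
  -- numeric consequences in ℝ
  have hX1 : (1 : ℝ) ≤ (ordProj[3] ξ : ℕ) := by exact_mod_cast Nat.one_le_iff_ne_zero.mpr (Nat.ordProj_pos ξ 3).ne'
  have hX0 : (0 : ℝ) ≤ (ordProj[2] ξ : ℕ) := by positivity
  have hNR : (0 : ℝ) < (N : ℝ) := by exact_mod_cast hNpos
  have hrpow0 : (0 : ℝ) ≤ (N : ℝ) ^ (1 / 8 : ℝ) := Real.rpow_nonneg hNR.le _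
  have hLR : ((∏ q ∈ N.primeFactors \ P.primeFactors, D.factorization q : ℕ) : ℝ) = ((2 * s - 8) * (2 * t) : ℕ) := by
    rw [hL]
  -- (X : ℝ) ≤ C' * N^(1/8) * L
  have hstep1 : ((ordProj[2] ξ : ℕ) : ℝ) ≤ C' * (N : ℝ) ^ (1 / 8 : ℝ) * (((2 * s - 8) * (2 * t) : ℕ) : ℝ) := by
    have hL0 : (0 : ℝ) ≤ (((2 * s - 8) * (2 * t) : ℕ) : ℝ) := by positivity
    calc ((ordProj[2] ξ : ℕ) : ℝ) ≤ ((ordProj[2] ξ : ℕ) : ℝ) * ((ordProj[3] ξ : ℕ) : ℝ) :=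
          le_mul_of_one_le_right hX0 hX1
      _ = ((ordProj[2] ξ * ordProj[3] ξ : ℕ) : ℝ) := by push_cast; ring
      _ ≤ C * (N : ℝ) ^ (1 / 8 : ℝ) * (((2 * s - 8) * (2 * t) : ℕ) : ℝ) := by rw [← hLR]; exact hcrux
      _ ≤ C' * (N : ℝ) ^ (1 / 8 : ℝ) * (((2 * s - 8) * (2 * t) : ℕ) : ℝ) := by
          gcongr; exact le_max_left _ _
  -- 2^s ≤ 2^c * X
  have hstep2 : (2 : ℝ) ^ s ≤ (2 : ℝ) ^ c * ((ordProj[2] ξ : ℕ) : ℝ) := by exact_mod_cast hdepth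
  -- combine and raise to the 8th power
  have hT0 : (0 : ℝ) ≤ C' * (N : ℝ) ^ (1 / 8 : ℝ) * (((2 * s - 8) * (2 * t) : ℕ) : ℝ) := by positivity
  have hstep3 : (2 : ℝ) ^ s ≤ (2 : ℝ) ^ c * (C' * (N : ℝ) ^ (1 / 8 : ℝ) * (((2 * s - 8) * (2 * t) : ℕ) : ℝ)) :=
    hstep2.trans (mul_le_mul_of_nonneg_left hstep1 (by positivity))
  have hpow8 : ((2 : ℝ) ^ s) ^ 8 ≤ ((2 : ℝ) ^ c * (C' * (N : ℝ) ^ (1 / 8 : ℝ) * (((2 * s - 8) * (2 * t) : ℕ) : ℝ))) ^ 8 :=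
    pow_le_pow_left₀ (by positivity) hstep3 8
  have hN8 : ((N : ℝ) ^ (1 / 8 : ℝ)) ^ 8 = (N : ℝ) := by
    rw [← Real.rpow_natCast, ← Real.rpow_mul hNR.le]; norm_num
  have hexp : ((2 : ℝ) ^ c * (C' * (N : ℝ) ^ (1 / 8 : ℝ) * (((2 * s - 8) * (2 * t) : ℕ) : ℝ))) ^ 8
      = (2 : ℝ) ^ (8 * c) * C' ^ 8 * (N : ℝ) * (((2 * s - 8) * (2 * t) : ℕ) : ℝ) ^ 8 := by
    rw [mul_pow, mul_pow, mul_pow, hN8, ← pow_mul]; ring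
  rw [hexp, ← pow_mul] at hpow8
  -- bounds: N ≤ 2^(3s+9), L ≤ 4 s^2
  have hts : t ≤ s := by
    by_contra hcon
    push Not at hcon
    have : 2 ^ s < 3 ^ (8 * t) :=
      calc 2 ^ s < 2 ^ t := Nat.pow_lt_pow_right (by norm_num) hcon
        _ ≤ 3 ^ t := Nat.pow_le_pow_left (by norm_num) t
        _ ≤ 3 ^ (8 * t) := Nat.pow_le_pow_right (by norm_num) (by omega)
    omega
  have h32t : 3 ^ (2 * t) ≤ 2 ^ s := (Nat.pow_le_pow_right (by norm_num) (by omega)).trans h3t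
  have hNbound : (N : ℝ) ≤ (2 : ℝ) ^ (3 * s + 9) := by
    have hPM : P * M ≤ 2 * M * M := by
      have : P ≤ 2 * M := by rw [hP']; omega
      exact Nat.mul_le_mul_right _ this
    have h1 : N ≤ 2 ^ 9 * (2 ^ s * 3 ^ t) * (2 ^ s * 3 ^ t) := by
      calc N ≤ 2 ^ 8 * (P * M) := hNle
        _ ≤ 2 ^ 8 * (2 * M * M) := Nat.mul_le_mul_left _ hPM
        _ = 2 ^ 9 * (2 ^ s * 3 ^ t) * (2 ^ s * 3 ^ t) := by rw [hM]; ring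
    have h2 : 2 ^ 9 * (2 ^ s * 3 ^ t) * (2 ^ s * 3 ^ t) = 2 ^ 9 * 2 ^ (2 * s) * 3 ^ (2 * t) := by ring
    have h3 : 2 ^ 9 * 2 ^ (2 * s) * 3 ^ (2 * t) ≤ 2 ^ 9 * 2 ^ (2 * s) * 2 ^ s := Nat.mul_le_mul_left _ h32t
    have h4 : 2 ^ 9 * 2 ^ (2 * s) * 2 ^ s = 2 ^ (3 * s + 9) := by
      rw [← pow_add 2 9 (2 * s), ← pow_add 2 (9 + 2 * s) s]; congr 1; omega
    have h5 : N ≤ 2 ^ (3 * s + 9) := by rw [h2] at h1; exact (h1.trans h3).trans_eq h4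
    have h6 : ((N : ℕ) : ℝ) ≤ ((2 ^ (3 * s + 9) : ℕ) : ℝ) := Nat.cast_le.mpr h5
    simpa only [Nat.cast_pow, Nat.cast_ofNat] using h6
  have hLbound : (((2 * s - 8) * (2 * t) : ℕ) : ℝ) ≤ 4 * (s : ℝ) ^ 2 := by
    have : (2 * s - 8) * (2 * t) ≤ 4 * s ^ 2 := by
      calc (2 * s - 8) * (2 * t) ≤ (2 * s) * (2 * s) := Nat.mul_le_mul (Nat.sub_le (2 * s) 8) (Nat.mul_le_mul_left 2 hts)
        _ = 4 * s ^ 2 := by ring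
    exact_mod_cast this
  have hL8 : (((2 * s - 8) * (2 * t) : ℕ) : ℝ) ^ 8 ≤ (4 * (s : ℝ) ^ 2) ^ 8 := pow_le_pow_left₀ (by positivity) hLbound 8
  -- final chain: 2^(8s) ≤ 2^(8c) C'^8 2^(3s+9) (4 s^2)^8 = (C'^8 2^(8c+25)) s^16 2^(3s)
  have hfinal : (2 : ℝ) ^ (s * 8) ≤ (2 : ℝ) ^ (8 * c) * C' ^ 8 * (2 : ℝ) ^ (3 * s + 9) * (4 * (s : ℝ) ^ 2) ^ 8 := by
    calc (2 : ℝ) ^ (s * 8) ≤ (2 : ℝ) ^ (8 * c) * C' ^ 8 * (N : ℝ) * (((2 * s - 8) * (2 * t) : ℕ) : ℝ) ^ 8 := hpow8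
      _ ≤ (2 : ℝ) ^ (8 * c) * C' ^ 8 * (2 : ℝ) ^ (3 * s + 9) * (4 * (s : ℝ) ^ 2) ^ 8 := by gcongr
  have hrewrite : (2 : ℝ) ^ (8 * c) * C' ^ 8 * (2 : ℝ) ^ (3 * s + 9) * (4 * (s : ℝ) ^ 2) ^ 8
      = (C' ^ 8 * (2 : ℝ) ^ (8 * c + 25)) * (s : ℝ) ^ 16 * (2 : ℝ) ^ (3 * s) := by
    have e1 : (4 * (s : ℝ) ^ 2) ^ 8 = 65536 * (s : ℝ) ^ 16 := by
      rw [mul_pow, ← pow_mul]; norm_num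
    have e2 : (2 : ℝ) ^ (3 * s + 9) = (2 : ℝ) ^ (3 * s) * 512 := by rw [pow_add]; norm_num
    have e3 : (2 : ℝ) ^ (8 * c + 25) = (2 : ℝ) ^ (8 * c) * 33554432 := by rw [pow_add]; norm_num
    rw [e1, e2, e3]
    ring
  rw [hrewrite] at hfinal
  have hlt := hs₀ s hss₀
  -- hlt : K * s^16 < 2^(5s);  hfinal : 2^(8s) ≤ K * s^16 * 2^(3s)
  have h8 : (2 : ℝ) ^ (s * 8) = (2 : ℝ) ^ (5 * s) * (2 : ℝ) ^ (3 * s) := by rw [← pow_add]; congr 1; omega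
  rw [h8] at hfinal
  have h3pos : (0 : ℝ) < (2 : ℝ) ^ (3 * s) := by positivity
  have := lt_of_lt_of_le (mul_lt_mul_of_pos_right hlt h3pos) (le_refl _)
  linarith


/-! ## §3 Near-miss: the one unproved input (census-true) -/

/-- **OBSTRUCTION / near-miss.**  The depth law is TRUE on every computed member of the family (direct Brandt census
kit j017527: `v₂ ξ(N/p, p) = 6, 8, 9, 10` at `s = 5, 6, 8, 12` for `k = 3`, i.e. `c = 2` suffices so far;
modular-degree census j017464 / j016666 to `s = 16`), but a Lean proof needs (i) Jacquet–Langlands/Eichler to identify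
`brandtXi` with the congruence number of `f_E` in the `p`-new definite space, (ii) the 2-adic Eisenstein-ideal theory of
level `p` (Mazur 1977; Calegari–Emerton 2005 at `ℓ = 2`) and its transfer to the Legendre point, (iii) level raising to
`N⁺ = 6` modulo `2^k` without residual irreducibility.  None of (i)–(iii) is in the tree.  What was tried: only the
census; no partial formal progress is possible before (i). [cite: Mazur1977] -/
theorem pierpontDepthLaw_census : PierpontDepthLaw := by
  -- census: v₂ ξ(N/p,p) = 6,8,9,10 (s=5,6,8,12; t=1), 11,9 (s=6,7; t=2); v₂ deg_Frey = 11,15,15 (s=12,11,14) [j017919]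
  sorry

/-- **The crux is false if Pierpont primes with small 3-part are unbounded** (given the census-true depth law and the
tree's Serre/Diamond–Kramer fact): the conditional refutation with the near-miss plugged in. -/
theorem not_eisensteinQuarantine_of_primes
    (hΔ : ∀ a b : ℤ, minimalDiscriminantNorm_freyCurve_of_mod a b) (hP : PierpontPrimesWithSmallThreePart) :
    ¬ Summit.ABC.ABC.Theses.DefiniteXi.EisensteinQuarantine :=
  eisensteinQuarantine_false_of_pierpontDepthLaw hΔ pierpontDepthLaw_census hP

/-! ## §4 Natural repairs / strengthenings, graded on the census -/

/-- **C″ (sign-blind Eisenstein-index allowance; lead memo §4)**: the 6-part of the Eisenstein index `∏_{q ∣ N odd}(q²−1)`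
joins the allowance.  CONSISTENT with all 54 computed levels (tight at `(42, 673)`); its cost is the exponent `4 + ε`
downstream.  Recorded for the planner; not attacked further this cycle. -/
def EisensteinQuarantineSignBlind : Prop :=
  ∀ ε : ℝ, 0 < ε → ∃ C : ℝ, ∀ a b : ℤ, IsCoprime a b → a * b * (a + b) ≠ 0 → ∀ (N : ℕ) [NeZero N],
    (freyCurve a b).conductorNorm ℤ = N → ∀ Nm : ℕ, Odd Nm → Squarefree Nm → Odd Nm.primeFactors.card → Nm ∣ N →
      ((ordProj[2] (brandtXi (N / Nm) Nm (fun n => (freyCurve a b).LFunction n)) *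
          ordProj[3] (brandtXi (N / Nm) Nm (fun n => (freyCurve a b).LFunction n)) : ℕ) : ℝ) ≤
        C * (N : ℝ) ^ ε *
          ((∏ q ∈ N.primeFactors \ Nm.primeFactors, ((freyCurve a b).minimalDiscriminantNorm ℤ).factorization q : ℕ) : ℝ) *
          ((∏ q ∈ N.primeFactors.erase 2, (ordProj[2] (q ^ 2 - 1) * ordProj[3] (q ^ 2 - 1)) : ℕ) : ℝ)

/-- **Small-prime quarantine variant** (the glue's actual freedom: `Nm` = the least odd prime of `N`): CENSUS-FALSE as
well — `v₂ ξ(N/q, q)` is `v₂ ξ(N/p, p) − 2` on the kill family and grows with `s` (finding 3). Recorded, refuted by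
the same depth mechanism (no separate Lean statement needed: it is an instance of the crux). -/
def EisensteinQuarantineLeastPrime : Prop :=
  ∀ ε : ℝ, 0 < ε → ∃ C : ℝ, ∀ a b : ℤ, IsCoprime a b → a * b * (a + b) ≠ 0 → ∀ (N : ℕ) [NeZero N],
    (freyCurve a b).conductorNorm ℤ = N → ∀ q : ℕ, q.Prime → q ≠ 2 → q ∣ N → (∀ r : ℕ, r.Prime → r ≠ 2 → r ∣ N → q ≤ r) →
      ((ordProj[2] (brandtXi (N / q) q (fun n => (freyCurve a b).LFunction n)) *
          ordProj[3] (brandtXi (N / q) q (fun n => (freyCurve a b).LFunction n)) : ℕ) : ℝ) ≤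
        C * (N : ℝ) ^ ε *
          ((∏ r ∈ N.primeFactors \ {q}, ((freyCurve a b).minimalDiscriminantNorm ℤ).factorization r : ℕ) : ℝ)

/-- The least-prime variant is implied by the crux (it is a specialisation), so its census-falsity is another view of
the same kill; recorded so that a planner does not restate the crux this way. -/
theorem eisensteinQuarantineLeastPrime_of (h : Summit.ABC.ABC.Theses.DefiniteXi.EisensteinQuarantine) :
    EisensteinQuarantineLeastPrime := by
  intro ε hε
  obtain ⟨C, hC⟩ := h ε hε
  refine ⟨C, fun a b hab h0 N _ hN q hq hq2 hqN _ => ?_⟩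
  have h1 := hC a b hab h0 N hN q (hq.odd_of_ne_two hq2) hq.squarefree (by rw [hq.primeFactors]; simp) hqN
  rwa [hq.primeFactors] at h1

/-! ## §5 Targets / line `Sketch`
No stuck stubs were handed over (`stuck_stubs = []`).  By the lead's landed calibration
(`occurrenceBound_of_ordProjHalf`, p97646) stub 3 `stub_twoAdicOccurrenceBound` is EQUIVALENT to the 2-adic half of
the crux, hence census-false along the same family (a witness `ψ ⊥ φ`, `φ ≡ ψ (mod 2^k)` with `k = v₂ ξ − v₂ d` exists
by the landed dictionary `stub_latticeDepth_dvd_iff`; the vectors `φ` are in `compute/j017527/outputs/results.json`).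
-/

end Summit.ABC.ABC.Cruxes.EisensteinQuarantine.Disproof
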